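import Mathlib
import Summits.ValiantsHypothesis.ValiantsHypothesis.Theorems.GrenetZeonPolySizeQPAlgebraSymmetrisedFormReadOut
import Summits.ValiantsHypothesis.ValiantsHypothesis.Theorems.GrenetZeonPolySizeQPAlgebraAdjugateLengthOneTwoOneOne
import Summits.ValiantsHypothesis.ValiantsHypothesis.Theorems.GrenetZeonPolySizeQPAlgebraTopWindow
import Summits.ValiantsHypothesis.ValiantsHypothesis.Theorems.GrenetZeonPolySizeQPAlgebraBlockRankGeneral
import HarnessLib

/-!
# Crux `GrenetZeon.PolySizeQPAlgebra` (stmt-ValiantsHypothesis-8064), line `vbp-slice-dealg` —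
# `G(3) ≤ 29` for the deep dimension-five type `(1,2,1,1)` = `ℂ[x,y]/(xy, y² - x³)`

With `…SymmetrisedFormReadOut` the symmetrised `3 × 3` form `G` of `…BlockRankGeneral` at a residual
block `S ∈ Mat₃(𝔪)` has `rank G ≤ dim_ℂ V` for any `ℂ`-subspace `V ⊆ R × Mat₃(R)` containing the
representing vectors `Ψ_s`.  Over the presented ring `R = ℂ[x,y]/(xy, y² - x³)` (`xy = 0`, `y² = x³`,
`x⁴ = 0`, `R = ℂ + Rx + Ry`) the `𝔪`-adic filtration gives such a `V` of dimension `≤ 29`: writing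
`Z_s = Y₀ + Y₁` with `Y₀` scalar and `Y₁ ∈ Mat₃(𝔪)`, `Ψ_s = Ψ⁰(Y₀) + B_s` where `Ψ⁰` is `ℂ`-linear (so
`Ψ⁰(Y₀)` lies in the span of the nine vectors `Ψ⁰(E_{ij})`) and every coordinate of `B_s` lies in
`𝔪² = x²R = ℂx² + ℂx³` (the `2 × 2` minors of `S`, and `3 × 3` determinants with two rows in `𝔪`).  Hence

* `rank_symmetrised_fin_three_form_le_of_oneTwoOneOne` — **`rank G ≤ 29 (< 30 = 2·3·dim R)`**, i.e. the
  input `G(3)` of `rank_hess0_transl_le_of_blockNormalForm_general_of_AL` for this type, and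
* `rank_hess0_transl_le_blockNormalForm_three_of_oneTwoOneOne` — with `AL(3)`
  (`…AdjugateLengthOneTwoOneOne`): at a block normal form `diag(1_κ, S)`, `S ∈ Mat₃(𝔪)`, `det S = 0`,
  over this type, `rank Hess λ(det A)(p) ≤ 29 + 2|κ|·dim R ≤ 2·dim R·(|κ| + 3)` when `dim R ≥ 5`.

HONEST FRAMING: the residual-corank-3 count for one local type in presented form; the classification
"deep of dimension 5 ⟹ this presentation", the transport to the hypothesis `hH` of
`not_hasAlgDetRepr_perPoly_self_of_deepBound`, and input (A₆) remain.  No stub of the line is closed;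
VP ≠ VNP is not moved.

References: T. Mignon, N. Ressayre, IMRN 2004:79, §2 [MignonRessayre2004].
-/

noncomputable section

open Matrix MvPolynomial
open Literature.Computability.AlgebraicComplexity

-- single-conjunct layout `Summits/ValiantsHypothesis/ValiantsHypothesis`: duplicated namespace by design
set_option linter.dupNamespace false

namespace Summit.ValiantsHypothesis.ValiantsHypothesis.Theorems.GrenetZeonPolySizeQPAlgebra

section GThree

variable {R : Type*} [CommRing R]

/-- For `r r' : Fin 3` there is a third index `m ∉ {r, r'}`. [folklore] -/
theorem exists_fin_three_ne_ne (r r' : Fin 3) : ∃ m : Fin 3, m ≠ r ∧ m ≠ r' := by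
  revert r r'; decide

/-- A `3 × 3` determinant with row `r'` replaced by a row in the ideal `I` and another untouched row of
`S ∈ Mat₃(I)` lies in `I²`. [folklore] -/
theorem det_updateRow_updateRow_mem_sq (I : Ideal R) (S : Matrix (Fin 3) (Fin 3) R)
    (hS : ∀ i j, S i j ∈ I) (r r' : Fin 3) (hr : r' ≠ r) (v w : Fin 3 → R) (hw : ∀ j, w j ∈ I) :
    ((S.updateRow r v).updateRow r' w).det ∈ I ^ 2 := by
  classical
  obtain ⟨m, hmr, hmr'⟩ := exists_fin_three_ne_ne r r'
  have hcard : ({r', m} : Finset (Fin 3)).card = 2 := Finset.card_pair (Ne.symm hmr')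
  have h := det_mem_pow_of_rows_mem I ((S.updateRow r v).updateRow r' w) {r', m} fun i hi j => by
    rcases Finset.mem_insert.1 hi with rfl | hi
    · rw [Matrix.updateRow_self]; exact hw j
    · rw [Finset.mem_singleton] at hi
      subst hi
      rw [Matrix.updateRow_ne hmr', Matrix.updateRow_ne hmr]
      exact hS i j
  rwa [hcard] at h

/-- In the presented ring: `(x, y)² ⊆ x²R`. [folklore] -/
theorem sq_span_pair_le_span_sq {x y : R} (hxy : x * y = 0) (hyy : y * y = x ^ 3) :
    (Ideal.span {x, y} : Ideal R) ^ 2 ≤ Ideal.span {x ^ 2} := by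
  rw [pow_two, Ideal.mul_le]
  intro u hu v hv
  obtain ⟨a, b, rfl⟩ := Ideal.mem_span_pair.1 hu
  obtain ⟨c, d, rfl⟩ := Ideal.mem_span_pair.1 hv
  obtain ⟨t, ht⟩ := mul_mem_sq_of_rel hxy hyy ⟨a, b, rfl⟩ ⟨c, d, rfl⟩
  exact Ideal.mem_span_singleton'.2 ⟨t, ht.symm⟩

variable [Algebra ℂ R] [Module.Finite ℂ R]

/-- **`G(3) ≤ 29` for the type `(1,2,1,1)`.**  Let `R` be a finite-dimensional commutative `ℂ`-algebra
with `x, y` such that `xy = 0`, `y² = x³`, `x⁴ = 0` and `R = ℂ + Rx + Ry` (the local algebra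
`ℂ[x,y]/(xy, y² - x³)`), `S ∈ Mat₃((x, y))`, `λ : R → ℂ` linear, `τ : σ → R`, `Z : σ → Mat₃(R)`.  Then the
symmetrised form `G = ((s,t) ↦ λ(τ_s tr(adj S·Z_t) + τ_t tr(adj S·Z_s) + Σ_{r≠r'} det(S | r ← (Z_t)_r,
r' ← (Z_s)_{r'})))` has rank `≤ 29`. [cite: MignonRessayre2004, §2] -/
theorem rank_symmetrised_fin_three_form_le_of_oneTwoOneOne {σ : Type*} [Fintype σ] {x y : R}
    (hxy : x * y = 0) (hyy : y * y = x ^ 3) (hx4 : x ^ 4 = 0)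
    (hloc : ∀ r : R, ∃ (c : ℂ) (a b : R), r = algebraMap ℂ R c + a * x + b * y)
    (l : R →ₗ[ℂ] ℂ) (S : Matrix (Fin 3) (Fin 3) R) (hS : ∀ i j, ∃ a b, S i j = a * x + b * y)
    (τ : σ → R) (Z : σ → Matrix (Fin 3) (Fin 3) R) :
    (Matrix.of fun s t => l (τ s * (S.adjugate * Z t).trace + τ t * (S.adjugate * Z s).trace +
      ∑ r, ∑ r', if r' = r then 0 else ((S.updateRow r (Z t r)).updateRow r' (Z s r')).det)).rank ≤
      29 := by
  classical
  -- notation-free abbreviations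
  set E : Fin 3 → Fin 3 → Matrix (Fin 3) (Fin 3) R := fun k l => Matrix.single k l 1 with hE
  -- the outer functionals `h_kl`
  have hcomm : ∀ (Y : Matrix (Fin 3) (Fin 3) R) (k l : Fin 3),
      (∑ r, ∑ r', if r' = r then 0 else ((S.updateRow r (Y r)).updateRow r' (E k l r')).det) =
        ∑ r, ∑ r', if r' = r then 0 else ((S.updateRow r (E k l r)).updateRow r' (Y r')).det :=
    fun Y k l => sum_det_updateRow_updateRow_comm S (E k l) Y
  -- the ideal `𝔪 = (x, y)` and `x²R`
  set I : Ideal R := Ideal.span {x, y} with hI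
  have hSI : ∀ i j, S i j ∈ I := fun i j => by
    obtain ⟨a, b, h⟩ := hS i j
    exact Ideal.mem_span_pair.2 ⟨a, b, h.symm⟩
  have hI2 : I ^ 2 ≤ Ideal.span {x ^ 2} := sq_span_pair_le_span_sq hxy hyy
  -- `x²R = ℂx² + ℂx³`
  have hsq : ∀ z : R, z ∈ Ideal.span {x ^ 2} → ∃ c c' : ℂ, z = c • x ^ 2 + c' • x ^ 3 := by
    intro z hz
    obtain ⟨t, rfl⟩ := Ideal.mem_span_singleton'.1 hz
    exact mul_sq_eq_smul_add_smul hxy hx4 hloc t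
  -- adjugate traces lie in `x²R`
  have hβ : ∀ Y : Matrix (Fin 3) (Fin 3) R, (S.adjugate * Y).trace ∈ Ideal.span {x ^ 2} := by
    intro Y
    rw [Matrix.trace]
    refine Ideal.sum_mem _ fun i _ => ?_
    rw [Matrix.diag_apply, Matrix.mul_apply]
    refine Ideal.sum_mem _ fun j _ => Ideal.mul_mem_right _ _ ?_
    obtain ⟨t, ht⟩ := adjugate_apply_mem_sq_of_rel hxy hyy S hS i j
    exact Ideal.mem_span_singleton'.2 ⟨t, ht.symm⟩
  -- the outer functional at a matrix with entries in `𝔪` lies in `x²R`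
  have hh : ∀ (Y : Matrix (Fin 3) (Fin 3) R), (∀ i j, Y i j ∈ I) → ∀ k l,
      (∑ r, ∑ r', if r' = r then 0 else ((S.updateRow r (E k l r)).updateRow r' (Y r')).det) ∈
        Ideal.span {x ^ 2} := by
    intro Y hY k l
    refine Ideal.sum_mem _ fun r _ => Ideal.sum_mem _ fun r' _ => ?_
    split_ifs with h
    · exact Ideal.zero_mem _
    · exact hI2 (det_updateRow_updateRow_mem_sq I S hSI r r' h _ _ fun j => hY r' j)
  -- the `ℂ`-linear map `Ψ⁰ : Y ↦ (β Y, (h_kl Y)_{kl})`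
  let Ψ₀ : Matrix (Fin 3) (Fin 3) R →ₗ[ℂ] R × Matrix (Fin 3) (Fin 3) R :=
    { toFun := fun Y => ((S.adjugate * Y).trace, Matrix.of fun k l =>
        ∑ r, ∑ r', if r' = r then 0 else ((S.updateRow r (E k l r)).updateRow r' (Y r')).det)
      map_add' := fun Y₁ Y₂ => by
        ext
        · simp only [Matrix.mul_add, Matrix.trace_add, Prod.fst_add]
        · simp only [Matrix.of_apply, Prod.snd_add, Matrix.add_apply]
          exact sum_det_updateRow_add _ _ _
      map_smul' := fun c Y => by
        ext
        · simp only [Matrix.mul_smul, Matrix.trace_smul, Prod.smul_fst, RingHom.id_apply]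
        · simp only [Matrix.of_apply, Prod.smul_snd, Matrix.smul_apply, RingHom.id_apply]
          rw [show c • Y = (algebraMap ℂ R c) • Y from (algebraMap_smul R c Y).symm,
            sum_det_updateRow_smul, ← Algebra.smul_def] }
  -- the two subspaces
  set V₁ : Submodule ℂ (R × Matrix (Fin 3) (Fin 3) R) :=
    Submodule.span ℂ (Set.range fun kl : Fin 3 × Fin 3 => Ψ₀ (E kl.1 kl.2)) with hV₁
  let T₂ : (ℂ × ℂ) × (Fin 3 → Fin 3 → ℂ × ℂ) →ₗ[ℂ] R × Matrix (Fin 3) (Fin 3) R :=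
    { toFun := fun p => (p.1.1 • x ^ 2 + p.1.2 • x ^ 3,
        Matrix.of fun k l => (p.2 k l).1 • x ^ 2 + (p.2 k l).2 • x ^ 3)
      map_add' := fun p p' => by
        ext
        · simp only [Prod.fst_add, Prod.snd_add, add_smul]; abel
        · simp only [Prod.snd_add, Pi.add_apply, Prod.fst_add, Matrix.of_apply, Matrix.add_apply,
            add_smul]; abel
      map_smul' := fun c p => by
        ext
        · simp only [Prod.smul_fst, Prod.smul_snd, smul_eq_mul, RingHom.id_apply, smul_add, mul_smul]
        · simp only [Prod.smul_snd, Pi.smul_apply, Prod.smul_fst, smul_eq_mul, Matrix.of_apply,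
            RingHom.id_apply, Matrix.smul_apply, smul_add, mul_smul] }
  set V₂ : Submodule ℂ (R × Matrix (Fin 3) (Fin 3) R) := LinearMap.range T₂ with hV₂
  have hV₁9 : Module.finrank ℂ V₁ ≤ 9 := by
    have h := finrank_range_le_card (R := ℂ) fun kl : Fin 3 × Fin 3 => Ψ₀ (E kl.1 kl.2)
    simpa [Set.finrank] using h
  have hV₂20 : Module.finrank ℂ V₂ ≤ 20 := by
    refine (LinearMap.finrank_range_le T₂).trans ?_
    simp [Module.finrank_prod, Module.finrank_pi_fintype]
  -- membership of the representing vectors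
  have hmem : ∀ s, ((S.adjugate * Z s).trace,
      Matrix.of fun k l => τ s * (S.adjugate * Matrix.single k l 1).trace +
        ∑ r, ∑ r', if r' = r then 0 else
          ((S.updateRow r (Z s r)).updateRow r' (Matrix.single k l (1 : R) r')).det) ∈ V₁ ⊔ V₂ := by
    intro s
    -- split `Z s = Y₀ + Y₁`
    choose c a b hcab using fun k l => hloc (Z s k l)
    set Y₀ : Matrix (Fin 3) (Fin 3) R := Matrix.of fun k l => algebraMap ℂ R (c k l) with hY₀
    set Y₁ : Matrix (Fin 3) (Fin 3) R := Z s - Y₀ with hY₁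
    have hZ : Z s = Y₀ + Y₁ := by rw [hY₁]; abel
    have hY₁I : ∀ i j, Y₁ i j ∈ I := by
      intro i j
      rw [hY₁, Matrix.sub_apply, hY₀, Matrix.of_apply, hcab i j]
      refine Ideal.mem_span_pair.2 ⟨a i j, b i j, by ring⟩
    -- the `V₁` part
    have hA : Ψ₀ Y₀ ∈ V₁ := by
      have hY₀sum : Y₀ = ∑ i, ∑ j, c i j • E i j := by
        rw [Matrix.matrix_eq_sum_single Y₀]
        refine Finset.sum_congr rfl fun i _ => Finset.sum_congr rfl fun j _ => ?_
        rw [hY₀, Matrix.of_apply, Algebra.algebraMap_eq_smul_one, ← Matrix.smul_single]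
      rw [hY₀sum, map_sum]
      refine Submodule.sum_mem _ fun i _ => ?_
      rw [map_sum]
      refine Submodule.sum_mem _ fun j _ => ?_
      rw [map_smul]
      exact Submodule.smul_mem _ _ (Submodule.subset_span ⟨(i, j), rfl⟩)
    -- the `V₂` part
    have hB1 : (S.adjugate * Y₁).trace ∈ Ideal.span {x ^ 2} := hβ Y₁
    have hB2 : ∀ k l, τ s * (S.adjugate * Matrix.single k l 1).trace +
        (∑ r, ∑ r', if r' = r then 0 else ((S.updateRow r (E k l r)).updateRow r' (Y₁ r')).det) ∈
        Ideal.span {x ^ 2} :=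
      fun k l => Ideal.add_mem _ (Ideal.mul_mem_left _ _ (hβ _)) (hh Y₁ hY₁I k l)
    obtain ⟨c₀, c₀', hc₀⟩ := hsq _ hB1
    choose d d' hdd using fun k l => hsq _ (hB2 k l)
    have hB : ((S.adjugate * Y₁).trace, Matrix.of fun k l =>
        τ s * (S.adjugate * Matrix.single k l 1).trace +
        ∑ r, ∑ r', if r' = r then 0 else ((S.updateRow r (E k l r)).updateRow r' (Y₁ r')).det) ∈
        V₂ := by
      refine ⟨((c₀, c₀'), fun k l => (d k l, d' k l)), ?_⟩
      ext
      · exact hc₀.symm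
      · simp only [Matrix.of_apply]
        exact (hdd _ _).symm
    -- assemble
    have hsplit : ((S.adjugate * Z s).trace,
        Matrix.of fun k l => τ s * (S.adjugate * Matrix.single k l 1).trace +
          ∑ r, ∑ r', if r' = r then 0 else
            ((S.updateRow r (Z s r)).updateRow r' (Matrix.single k l (1 : R) r')).det) =
        Ψ₀ Y₀ + ((S.adjugate * Y₁).trace, Matrix.of fun k l =>
          τ s * (S.adjugate * Matrix.single k l 1).trace +
          ∑ r, ∑ r', if r' = r then 0 else ((S.updateRow r (E k l r)).updateRow r' (Y₁ r')).det) := by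
      ext
      · change (S.adjugate * Z s).trace = (S.adjugate * Y₀).trace + (S.adjugate * Y₁).trace
        rw [hZ, Matrix.mul_add, Matrix.trace_add]
      · rename_i k l
        change τ s * (S.adjugate * Matrix.single k l 1).trace +
            (∑ r, ∑ r', if r' = r then 0 else
              ((S.updateRow r (Z s r)).updateRow r' (Matrix.single k l (1 : R) r')).det) =
          (∑ r, ∑ r', if r' = r then 0 else ((S.updateRow r (E k l r)).updateRow r' (Y₀ r')).det) +
            (τ s * (S.adjugate * Matrix.single k l 1).trace +
              ∑ r, ∑ r', if r' = r then 0 else ((S.updateRow r (E k l r)).updateRow r' (Y₁ r')).det)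
        have h1 := hcomm (Z s) k l
        simp only [hE] at h1 ⊢
        rw [h1, hZ, sum_det_updateRow_add]
        ring
    rw [hsplit]
    exact Submodule.add_mem_sup hA hB
  refine (rank_symmetrised_form_le_finrank l S τ Z (V₁ ⊔ V₂) hmem).trans ?_
  calc Module.finrank ℂ ↥(V₁ ⊔ V₂) ≤ Module.finrank ℂ V₁ + Module.finrank ℂ V₂ :=
        Submodule.finrank_add_le_finrank_add_finrank _ _
    _ ≤ 29 := by omega

/-- **`G(3) ≤ 2·3·dim R` for the type `(1,2,1,1)`** (`29 < 30 ≤ 6·dim R` when `dim R ≥ 5`).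
[cite: MignonRessayre2004, §2] -/
theorem rank_symmetrised_fin_three_form_le_of_oneTwoOneOne' {σ : Type*} [Fintype σ] {x y : R}
    (hxy : x * y = 0) (hyy : y * y = x ^ 3) (hx4 : x ^ 4 = 0)
    (hloc : ∀ r : R, ∃ (c : ℂ) (a b : R), r = algebraMap ℂ R c + a * x + b * y)
    (hR : 5 ≤ Module.finrank ℂ R)
    (l : R →ₗ[ℂ] ℂ) (S : Matrix (Fin 3) (Fin 3) R) (hS : ∀ i j, ∃ a b, S i j = a * x + b * y)
    (τ : σ → R) (Z : σ → Matrix (Fin 3) (Fin 3) R) :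
    (Matrix.of fun s t => l (τ s * (S.adjugate * Z t).trace + τ t * (S.adjugate * Z s).trace +
      ∑ r, ∑ r', if r' = r then 0 else ((S.updateRow r (Z t r)).updateRow r' (Z s r')).det)).rank ≤
      2 * 3 * Module.finrank ℂ R :=
  (rank_symmetrised_fin_three_form_le_of_oneTwoOneOne hxy hyy hx4 hloc l S hS τ Z).trans (by omega)

/-- **The residual-corank-`3` bound for the type `(1,2,1,1)`** (`AL(3)` + `G(3)` plugged into
`rank_hess0_transl_le_of_blockNormalForm_general_of_AL`).  Over the presented ring
`R = ℂ[x,y]/(xy, y² - x³)` (`xy = 0`, `y² = x³`, `x⁴ = 0`, `x³ ≠ 0`, `R = ℂ + Rx + Ry`, `dim R ≥ 5`), let `A`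
be a square matrix of affine forms over `R[x_σ]` indexed by `κ ⊕ Fin 3` with `A(p) = diag(1_κ, S)`,
`S ∈ Mat₃((x, y))`, `det S = 0`, and `F = λ(det A)` coefficientwise.  Then
`rank Hess F(p) ≤ 29 + 2|κ|·dim R`. [cite: MignonRessayre2004, §2] -/
theorem rank_hess0_transl_le_blockNormalForm_three_of_oneTwoOneOne {σ : Type*} [Fintype σ]
    [DecidableEq σ] {κ : Type*} [Fintype κ] [DecidableEq κ] {x y : R}
    (hxy : x * y = 0) (hyy : y * y = x ^ 3) (hx4 : x ^ 4 = 0) (hx3 : x ^ 3 ≠ 0)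
    (hloc : ∀ r : R, ∃ (c : ℂ) (a b : R), r = algebraMap ℂ R c + a * x + b * y)
    (hR : 5 ≤ Module.finrank ℂ R) (l : R →ₗ[ℂ] ℂ)
    (A : Matrix (κ ⊕ Fin 3) (κ ⊕ Fin 3) (MvPolynomial σ R)) (F : MvPolynomial σ ℂ)
    (hA : ∀ a b, (A a b).totalDegree ≤ 1) (hF : ∀ d, l (coeff d A.det) = coeff d F)
    (p : σ → ℂ) (S : Matrix (Fin 3) (Fin 3) R)
    (hB : A.map (eval fun i => algebraMap ℂ R (p i)) = Matrix.fromBlocks 1 0 0 S)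
    (hS : ∀ i j, ∃ a b, S i j = a * x + b * y) (hdet : S.det = 0) :
    (hess0 (transl p F)).rank ≤ 29 + 2 * Fintype.card κ * Module.finrank ℂ R := by
  classical
  exact rank_hess0_transl_le_of_blockNormalForm_general_of_AL l A F hA hF p S hB hdet
    (fun s => A.map fun a => eval (fun i => algebraMap ℂ R (p i)) (pderiv s a)) (fun _ => rfl)
    (rank_symmetrised_fin_three_form_le_of_oneTwoOneOne hxy hyy hx4 hloc l S hS
      (fun s => (A.map fun a => eval (fun i => algebraMap ℂ R (p i)) (pderiv s a)).toBlocks₁₁.trace)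
      (fun s => (A.map fun a => eval (fun i => algebraMap ℂ R (p i)) (pderiv s a)).toBlocks₂₂))
    (adjugateLength_three_le hxy hyy hx4 hx3 hloc hR S hS hdet)

/-- The same in the shape `2 · dim R · n`, `n = |κ| + 3` (`29 < 30 ≤ 6·dim R`): **input (B) of the
`c = 1` box at residual corank `3` for the type `(1,2,1,1)` in block normal form.**
[cite: MignonRessayre2004, §2] -/
theorem rank_hess0_transl_le_blockNormalForm_three_of_oneTwoOneOne' {σ : Type*} [Fintype σ]
    [DecidableEq σ] {κ : Type*} [Fintype κ] [DecidableEq κ] {x y : R}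
    (hxy : x * y = 0) (hyy : y * y = x ^ 3) (hx4 : x ^ 4 = 0) (hx3 : x ^ 3 ≠ 0)
    (hloc : ∀ r : R, ∃ (c : ℂ) (a b : R), r = algebraMap ℂ R c + a * x + b * y)
    (hR : 5 ≤ Module.finrank ℂ R) (l : R →ₗ[ℂ] ℂ)
    (A : Matrix (κ ⊕ Fin 3) (κ ⊕ Fin 3) (MvPolynomial σ R)) (F : MvPolynomial σ ℂ)
    (hA : ∀ a b, (A a b).totalDegree ≤ 1) (hF : ∀ d, l (coeff d A.det) = coeff d F)
    (p : σ → ℂ) (S : Matrix (Fin 3) (Fin 3) R)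
    (hB : A.map (eval fun i => algebraMap ℂ R (p i)) = Matrix.fromBlocks 1 0 0 S)
    (hS : ∀ i j, ∃ a b, S i j = a * x + b * y) (hdet : S.det = 0) :
    (hess0 (transl p F)).rank ≤ 2 * Module.finrank ℂ R * (Fintype.card κ + 3) := by
  have h := rank_hess0_transl_le_blockNormalForm_three_of_oneTwoOneOne hxy hyy hx4 hx3 hloc hR l A F
    hA hF p S hB hS hdet
  have h30 : 29 + 2 * Fintype.card κ * Module.finrank ℂ R ≤
      2 * Module.finrank ℂ R * (Fintype.card κ + 3) := by nlinarith
  exact h.trans h30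

end GThree

end Summit.ValiantsHypothesis.ValiantsHypothesis.Theorems.GrenetZeonPolySizeQPAlgebra

end
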